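import Summits.QuantumAdvantage.QuantumAdvantage.Theorems.CubicForrelationNearExactIsExactCubicFormR4ZTools
import Summits.QuantumAdvantage.QuantumAdvantage.Theorems.CubicForrelationNearExactIsExactCubicFormR4ZBudget
import Summits.QuantumAdvantage.QuantumAdvantage.Theorems.CubicForrelationNearExactIsExactCubicFormR4ZAffine
import Summits.QuantumAdvantage.QuantumAdvantage.Theorems.CubicForrelationNearExactIsExactCubicFormR4ZInter
import Summits.QuantumAdvantage.QuantumAdvantage.Theorems.CubicForrelationNearExactIsExactCubicFormR4Cells

/-!
# Crux `CubicForrelation.NearExactIsExact` (stmt-QuantumAdvantage-14043) — E1280-even, R4 branch, descendant `0` (`HZ`): the TWO-FLAT CASE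

Certificate seat `b2b-cforr-cert` (gen 43).  HONEST FRAMING: kernel-checked theorem (standard axioms), R4-PARTNER §4 case `w = 2` reorganised:
in the adapted R4 frame with `t̄₇ = 0`, three zero cells `z₁, z₂, z₃` whose flat `A = z₁ + D` carries the structure
`β_v = c_x(v)·X ⊕ c_y(v)·Y` (…CubicFormR4ZCoset) with `X, Y, X ⊕ Y ≠ 0`.  Then (`tq0_flat`) `False`:
the nonzero cells weigh `≥ 32`, at most four cells are zero, so (budget) some nonzero cell `v₁ ∈ Z₁₀` weighs `< 48` (rank `2`,
…CubicFormR4ZQuad `tq0_rad32`); either a second light cell has a different form — then the two `32`-element radicals meet in `≥ 8` vectors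
(…CubicFormR4ZInter) killing all forms, and the pigeonhole (★) of …CubicFormR4ZTools (`8 > 2^{n₆₄}`, `n₆₄ ≤ 1` by
…CubicFormR4ZBudget `tq0_budget_two64z`) gives a radical vector — or all light cells share the form of `v₁`, and the affine function
`α = a·(v ⊕ z₁)` with `a ⊥ D, a ⊥ c(v₁)` (…CubicFormR4ZBudget `tq0_orth3`) has cells `≥ 48` on `{α = 1}`: `tq0_budget_2flat`.
Nothing about `θ₁₂`; NOT summit progress.

References: this seat lineage (g37 R4-PARTNER §4, g43 LEAN-GEN43).  Axioms: the standard three.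
-/

set_option linter.dupNamespace false -- D-0017: single-problem summit ⇒ `QuantumAdvantage.QuantumAdvantage` by design

namespace Summit.QuantumAdvantage.QuantumAdvantage.Theorems.CubicForrelation.NearExactIsExact

open Finset
open Literature.Computability.QuantumComplexity
open Literature.Computability.QuantumComplexity.BuzetChailloux (bxor zeroVec bxor_comm bxor_self bxor_zeroVec zeroVec_bxor
  bxor_bxor_cancel_left)

/-- **Descendant `0`, two-flat case.**  See the module docstring. [this work] -/
theorem tq0_flat (κ : (Fin (5 + 7) → Bool) → Bool) (hκ : IsDegLeFun 3 κ)
    (c d : Fin (5 + 7) → Fin (5 + 7) → Fin (5 + 7) → ZMod 2)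
    (hdc : ∀ φ j k, d j φ k = d φ j k) (hds : ∀ φ j k, d φ k j = d φ j k)
    (hd : ∀ φ j k, d φ j k =
      if ((((κ zeroVec ^^ κ (bxor zeroVec (fun l => decide (l = k)))) ^^ (κ (bxor zeroVec (fun l => decide (l = j))) ^^ κ (bxor (bxor zeroVec (fun l => decide (l = j))) (fun l => decide (l = k))))) ^^
          ((κ (bxor zeroVec (fun l => decide (l = φ))) ^^ κ (bxor (bxor zeroVec (fun l => decide (l = φ))) (fun l => decide (l = k)))) ^^ (κ (bxor (bxor zeroVec (fun l => decide (l = φ))) (fun l => decide (l = j))) ^^ κ (bxor (bxor (bxor zeroVec (fun l => decide (l = φ))) (fun l => decide (l = j))) (fun l => decide (l = k))))))) = true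
      then 1 else 0)
    (hpair : ∀ p φ, (∑ j, ∑ k, (if j < k then c p j k * d φ j k else 0)) = if p = φ then 1 else 0)
    (hD : ∀ y, (κ y ^^ κ (bxor y (fun l => decide (l = Fin.castAdd 7 (0 : Fin 5))))) =
      ((y (Fin.castAdd 7 (1 : Fin 5)) && y (Fin.castAdd 7 (2 : Fin 5))) ^^ (y (Fin.castAdd 7 (3 : Fin 5)) && y (Fin.castAdd 7 (4 : Fin 5)))))
    (hF : ∀ j k, d (Fin.castAdd 7 (0 : Fin 5)) j k =
      (if (j = Fin.castAdd 7 (1 : Fin 5) ∧ k = Fin.castAdd 7 (2 : Fin 5)) ∨ (j = Fin.castAdd 7 (2 : Fin 5) ∧ k = Fin.castAdd 7 (1 : Fin 5)) then 1 else 0) +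
      (if (j = Fin.castAdd 7 (3 : Fin 5) ∧ k = Fin.castAdd 7 (4 : Fin 5)) ∨ (j = Fin.castAdd 7 (4 : Fin 5) ∧ k = Fin.castAdd 7 (3 : Fin 5)) then 1 else 0))
    (hlt : #(univ.filter fun y : Fin (5 + 7) → Bool => κ y = true) < 1280)
    (hzzz : ∀ σ τ υ : Fin 7, d (Fin.natAdd 5 σ) (Fin.natAdd 5 τ) (Fin.natAdd 5 υ) = 0)
    (z₁ z₂ z₃ : Fin 4 → Bool) (i j : Fin 4)
    (hP : ∀ v : Fin 4 → Bool, ∃ cx cy : Bool,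
      (∀ j' k' : Fin 7, ((κ (Fin.append (Matrix.vecCons false v) zeroVec) ^^ κ (Fin.append (Matrix.vecCons false v) (fun l => decide (l = k')))) ^^ (κ (Fin.append (Matrix.vecCons false v) (fun l => decide (l = j'))) ^^ κ (Fin.append (Matrix.vecCons false v) (bxor (fun l => decide (l = j')) (fun l => decide (l = k')))))) = ((cx && ((κ (Fin.append (Matrix.vecCons false (bxor z₁ (fun l => decide (l = i)))) zeroVec) ^^ κ (Fin.append (Matrix.vecCons false (bxor z₁ (fun l => decide (l = i)))) (fun l => decide (l = k')))) ^^ (κ (Fin.append (Matrix.vecCons false (bxor z₁ (fun l => decide (l = i)))) (fun l => decide (l = j'))) ^^ κ (Fin.append (Matrix.vecCons false (bxor z₁ (fun l => decide (l = i)))) (bxor (fun l => decide (l = j')) (fun l => decide (l = k'))))))) ^^ (cy && ((κ (Fin.append (Matrix.vecCons false (bxor z₁ (fun l => decide (l = j)))) zeroVec) ^^ κ (Fin.append (Matrix.vecCons false (bxor z₁ (fun l => decide (l = j)))) (fun l => decide (l = k')))) ^^ (κ (Fin.append (Matrix.vecCons false (bxor z₁ (fun l => decide (l = j)))) (fun l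 => decide (l = j'))) ^^ κ (Fin.append (Matrix.vecCons false (bxor z₁ (fun l => decide (l = j)))) (bxor (fun l => decide (l = j')) (fun l => decide (l = k'))))))))) ∧
      ((bxor (bxor (bxor v z₁) (fun l => cx && decide (l = i))) (fun l => cy && decide (l = j))) = zeroVec ∨ (bxor (bxor (bxor v z₁) (fun l => cx && decide (l = i))) (fun l => cy && decide (l = j))) = bxor z₁ z₂ ∨ (bxor (bxor (bxor v z₁) (fun l => cx && decide (l = i))) (fun l => cy && decide (l = j))) = bxor z₁ z₃ ∨ (bxor (bxor (bxor v z₁) (fun l => cx && decide (l = i))) (fun l => cy && decide (l = j))) = bxor z₂ z₃))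
    (hX : ∃ j' k' : Fin 7, ((κ (Fin.append (Matrix.vecCons false (bxor z₁ (fun l => decide (l = i)))) zeroVec) ^^ κ (Fin.append (Matrix.vecCons false (bxor z₁ (fun l => decide (l = i)))) (fun l => decide (l = k')))) ^^ (κ (Fin.append (Matrix.vecCons false (bxor z₁ (fun l => decide (l = i)))) (fun l => decide (l = j'))) ^^ κ (Fin.append (Matrix.vecCons false (bxor z₁ (fun l => decide (l = i)))) (bxor (fun l => decide (l = j')) (fun l => decide (l = k')))))) = true) (hY : ∃ j' k' : Fin 7, ((κ (Fin.append (Matrix.vecCons false (bxor z₁ (fun l => decide (l = j)))) zeroVec) ^^ κ (Fin.append (Matrix.vecCons false (bxor z₁ (fun l => decide (l = j)))) (fun l => decide (l = k')))) ^^ (κ (Fin.append (Matrix.vecCons false (bxor z₁ (fun l => decide (l = j)))) (fun l => decide (l = j'))) ^^ κ (Fin.append (Matrix.vecCons false (bxor z₁ (fun l => decide (l = j)))) (bxor (fun l => decide (l = j')) (fun l => decide (l = k')))))) = true)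
    (hXY : ∃ j' k' : Fin 7, ((κ (Fin.append (Matrix.vecCons false (bxor z₁ (fun l => decide (l = i)))) zeroVec) ^^ κ (Fin.append (Matrix.vecCons false (bxor z₁ (fun l => decide (l = i)))) (fun l => decide (l = k')))) ^^ (κ (Fin.append (Matrix.vecCons false (bxor z₁ (fun l => decide (l = i)))) (fun l => decide (l = j'))) ^^ κ (Fin.append (Matrix.vecCons false (bxor z₁ (fun l => decide (l = i)))) (bxor (fun l => decide (l = j')) (fun l => decide (l = k')))))) ≠ ((κ (Fin.append (Matrix.vecCons false (bxor z₁ (fun l => decide (l = j)))) zeroVec) ^^ κ (Fin.append (Matrix.vecCons false (bxor z₁ (fun l => decide (l = j)))) (fun l => decide (l = k')))) ^^ (κ (Fin.append (Matrix.vecCons false (bxor z₁ (fun l => decide (l = j)))) (fun l => decide (l = j'))) ^^ κ (Fin.append (Matrix.vecCons false (bxor z₁ (fun l => decide (l = j)))) (bxor (fun l => decide (l = j')) (fun l => decide (l = k'))))))) : False := by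
  classical
  -- budget, quadratic cells, weight levels
  have hbudget : #(univ.filter fun s : Fin 7 → Bool => κ (Fin.append (Matrix.vecCons false ![false, false, false, false]) s) = true) + #(univ.filter fun s : Fin 7 → Bool => κ (Fin.append (Matrix.vecCons false ![false, false, false, true]) s) = true) + #(univ.filter fun s : Fin 7 → Bool => κ (Fin.append (Matrix.vecCons false ![false, false, true, false]) s) = true) + #(univ.filter fun s : Fin 7 → Bool => κ (Fin.append (Matrix.vecCons false ![false, true, false, false]) s) = true) + #(univ.filter fun s : Fin 7 → Bool => κ (Fin.append (Matrix.vecCons false ![false, true, false, true]) s) = true) + #(univ.filter fun s : Fin 7 → Bool => κ (Fin.append (Matrix.vecCons false ![false, true, true, false]) s) = true) + #(univ.filter fun s : Fin 7 → Bool => κ (Fin.append (Matrix.vecCons false ![true, false, false, false]) s) = true) + #(univ.filter fun s : Fin 7 → Bool => κ (Fin.append (Matrix.vecCons false ![true, false, false, true]) s) = true) + #(univ.filter fun s : Fin 7 → Bool => κ (Fin.append (Matrix.vecCons false ![true, false, true, false]) s) = true) + #(univ.filter fun s : Fin 7 → Bool => κ (Fin.append (Matrix.vecCons false ![true, true, true,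 true]) s) = true) ≤ 255 := by
    have hwt := tc5_weight κ hD
    have h128 : (2 : ℕ) ^ 7 = 128 := by norm_num
    rw [h128] at hwt
    omega
  have hq : ∀ (v : Fin 4 → Bool) (u' v' w x : Fin 7 → Bool),
      ((((κ (Fin.append (Matrix.vecCons false v) x) ^^ κ (Fin.append (Matrix.vecCons false v) (bxor x w))) ^^ (κ (Fin.append (Matrix.vecCons false v) (bxor x v')) ^^ κ (Fin.append (Matrix.vecCons false v) (bxor (bxor x v') w)))) ^^
          ((κ (Fin.append (Matrix.vecCons false v) (bxor x u')) ^^ κ (Fin.append (Matrix.vecCons false v) (bxor (bxor x u') w))) ^^ (κ (Fin.append (Matrix.vecCons false v) (bxor (bxor x u') v')) ^^ κ (Fin.append (Matrix.vecCons false v) (bxor (bxor (bxor x u') v') w)))))) = false :=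
    fun v u' v' w x => tq0_cells_quadratic κ hκ d hd hzzz (Matrix.vecCons false v) u' v' w x
  have h32 : ∀ v : Fin 4 → Bool, (∀ s, κ (Fin.append (Matrix.vecCons false v) s) = false) ∨ 32 ≤ #(univ.filter fun s : Fin 7 → Bool => κ (Fin.append (Matrix.vecCons false v) s) = true) :=
    fun v => tq0_weight32 (fun s : Fin 7 → Bool => κ (Fin.append (Matrix.vecCons false v) s)) (hq v)
  have hW0 : ∀ v : Fin 4 → Bool, (∀ s, κ (Fin.append (Matrix.vecCons false v) s) = false) → #(univ.filter fun s : Fin 7 → Bool => κ (Fin.append (Matrix.vecCons false v) s) = true) = 0 := by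
    intro v h; rw [card_eq_zero, filter_eq_empty_iff]; intro s _ hs; rw [h s] at hs; exact Bool.false_ne_true hs
  have hWz : ∀ v : Fin 4 → Bool, #(univ.filter fun s : Fin 7 → Bool => κ (Fin.append (Matrix.vecCons false v) s) = true) = 0 → ∀ s, κ (Fin.append (Matrix.vecCons false v) s) = false := by
    intro v h s
    rw [card_eq_zero, filter_eq_empty_iff] at h
    by_contra hs
    exact h (mem_univ s) (by simpa using hs)
  have h32' : ∀ v : Fin 4 → Bool, ((v 0 && v 1) ^^ (v 2 && v 3)) = false → #(univ.filter fun s : Fin 7 → Bool => κ (Fin.append (Matrix.vecCons false v) s) = true) = 0 ∨ 32 ≤ #(univ.filter fun s : Fin 7 → Bool => κ (Fin.append (Matrix.vecCons false v) s) = true) :=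
    fun v _ => (h32 v).elim (fun h => Or.inl (hW0 v h)) Or.inr
  -- independence of `X` and `Y`
  have hindep : ∀ bx bz : Bool, (∀ j' k' : Fin 7, ((bx && ((κ (Fin.append (Matrix.vecCons false (bxor z₁ (fun l => decide (l = i)))) zeroVec) ^^ κ (Fin.append (Matrix.vecCons false (bxor z₁ (fun l => decide (l = i)))) (fun l => decide (l = k')))) ^^ (κ (Fin.append (Matrix.vecCons false (bxor z₁ (fun l => decide (l = i)))) (fun l => decide (l = j'))) ^^ κ (Fin.append (Matrix.vecCons false (bxor z₁ (fun l => decide (l = i)))) (bxor (fun l => decide (l = j')) (fun l => decide (l = k'))))))) ^^ (bz && ((κ (Fin.append (Matrix.vecCons false (bxor z₁ (fun l => decide (l = j)))) zeroVec) ^^ κ (Fin.append (Matrix.vecCons false (bxor z₁ (fun l => decide (l = j)))) (fun l => decide (l = k')))) ^^ (κ (Fin.append (Matrix.vecCons false (bxor z₁ (fun l => decide (l = j)))) (fun l => decide (l = j'))) ^^ κ (Fin.append (Matrix.vecCons false (bxor z₁ (fun l => decide (l = j)))) (bxor (fun l => decide (l = j')) (fun l => decide (l = k')))))))) = false) → bx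 = false ∧ bz = false := by
    intro bx bz h
    obtain ⟨jx, kx, hx⟩ := hX; obtain ⟨jy, ky, hy⟩ := hY; obtain ⟨jd, kd, hxy⟩ := hXY
    cases bx <;> cases bz
    · exact ⟨rfl, rfl⟩
    · have e1 := h jy ky; rw [hy] at e1; revert e1; cases ((κ (Fin.append (Matrix.vecCons false (bxor z₁ (fun l => decide (l = i)))) zeroVec) ^^ κ (Fin.append (Matrix.vecCons false (bxor z₁ (fun l => decide (l = i)))) (fun l => decide (l = ky)))) ^^ (κ (Fin.append (Matrix.vecCons false (bxor z₁ (fun l => decide (l = i)))) (fun l => decide (l = jy))) ^^ κ (Fin.append (Matrix.vecCons false (bxor z₁ (fun l => decide (l = i)))) (bxor (fun l => decide (l = jy)) (fun l => decide (l = ky)))))) <;> decide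
    · have e1 := h jx kx; rw [hx] at e1; revert e1; cases ((κ (Fin.append (Matrix.vecCons false (bxor z₁ (fun l => decide (l = j)))) zeroVec) ^^ κ (Fin.append (Matrix.vecCons false (bxor z₁ (fun l => decide (l = j)))) (fun l => decide (l = kx)))) ^^ (κ (Fin.append (Matrix.vecCons false (bxor z₁ (fun l => decide (l = j)))) (fun l => decide (l = jx))) ^^ κ (Fin.append (Matrix.vecCons false (bxor z₁ (fun l => decide (l = j)))) (bxor (fun l => decide (l = jx)) (fun l => decide (l = kx)))))) <;> decide
    · exfalso; apply hxy; have e1 := h jd kd; revert e1; cases ((κ (Fin.append (Matrix.vecCons false (bxor z₁ (fun l => decide (l = i)))) zeroVec) ^^ κ (Fin.append (Matrix.vecCons false (bxor z₁ (fun l => decide (l = i)))) (fun l => decide (l = kd)))) ^^ (κ (Fin.append (Matrix.vecCons false (bxor z₁ (fun l => decide (l = i)))) (fun l => decide (l = jd))) ^^ κ (Fin.append (Matrix.vecCons false (bxor z₁ (fun l => decide (l = i)))) (bxor (fun l => decide (l = jd)) (fun l => decide (l = kd)))))) <;> cases ((κ (Fin.append (Matrix.vecCons false (bxor z₁ (fun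 l => decide (l = j)))) zeroVec) ^^ κ (Fin.append (Matrix.vecCons false (bxor z₁ (fun l => decide (l = j)))) (fun l => decide (l = kd)))) ^^ (κ (Fin.append (Matrix.vecCons false (bxor z₁ (fun l => decide (l = j)))) (fun l => decide (l = jd))) ^^ κ (Fin.append (Matrix.vecCons false (bxor z₁ (fun l => decide (l = j)))) (bxor (fun l => decide (l = jd)) (fun l => decide (l = kd)))))) <;> decide
  -- zero cells lie in the flat `A = z₁ + D`
  have hzeroD : ∀ v : Fin 4 → Bool, #(univ.filter fun s : Fin 7 → Bool => κ (Fin.append (Matrix.vecCons false v) s) = true) = 0 → ((bxor v z₁) = zeroVec ∨ (bxor v z₁) = bxor z₁ z₂ ∨ (bxor v z₁) = bxor z₁ z₃ ∨ (bxor v z₁) = bxor z₂ z₃) := by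
    intro v hv
    obtain ⟨cx, cy, hT, hI⟩ := hP v
    have hz := hWz v hv
    obtain ⟨hcx, hcy⟩ := hindep cx cy (fun j' k' => by rw [← hT j' k', hz, hz, hz, hz]; rfl)
    subst hcx; subst hcy
    rw [tcf_smul_false, tcf_smul_false, bxor_zeroVec, bxor_zeroVec] at hI
    exact hI
  have hz4 : (if #(univ.filter fun s : Fin 7 → Bool => κ (Fin.append (Matrix.vecCons false ![false, false, false, false]) s) = true) = 0 then 1 else 0)
 +      (if #(univ.filter fun s : Fin 7 → Bool => κ (Fin.append (Matrix.vecCons false ![false, false, false, true]) s) = true) = 0 then 1 else 0)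
 +      (if #(univ.filter fun s : Fin 7 → Bool => κ (Fin.append (Matrix.vecCons false ![false, false, true, false]) s) = true) = 0 then 1 else 0)
 +      (if #(univ.filter fun s : Fin 7 → Bool => κ (Fin.append (Matrix.vecCons false ![false, true, false, false]) s) = true) = 0 then 1 else 0)
 +      (if #(univ.filter fun s : Fin 7 → Bool => κ (Fin.append (Matrix.vecCons false ![false, true, false, true]) s) = true) = 0 then 1 else 0)
 +      (if #(univ.filter fun s : Fin 7 → Bool => κ (Fin.append (Matrix.vecCons false ![false, true, true, false]) s) = true) = 0 then 1 else 0)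
 +      (if #(univ.filter fun s : Fin 7 → Bool => κ (Fin.append (Matrix.vecCons false ![true, false, false, false]) s) = true) = 0 then 1 else 0)
 +      (if #(univ.filter fun s : Fin 7 → Bool => κ (Fin.append (Matrix.vecCons false ![true, false, false, true]) s) = true) = 0 then 1 else 0)
 +      (if #(univ.filter fun s : Fin 7 → Bool => κ (Fin.append (Matrix.vecCons false ![true, false, true, false]) s) = true) = 0 then 1 else 0)
 +      (if #(univ.filter fun s : Fin 7 → Bool => κ (Fin.append (Matrix.vecCons false ![true, true, true, true]) s) = true) = 0 then 1 else 0) ≤ 4 := by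
    rw [← tq0_sum_Z10 (fun v => if #(univ.filter fun s : Fin 7 → Bool => κ (Fin.append (Matrix.vecCons false v) s) = true) = 0 then 1 else 0), sum_boole]
    have hsub : (univ.filter fun v : Fin 4 → Bool => ((v 0 && v 1) ^^ (v 2 && v 3)) = false).filter (fun v => #(univ.filter fun s : Fin 7 → Bool => κ (Fin.append (Matrix.vecCons false v) s) = true) = 0) ⊆
        ({z₁, z₂, z₃, bxor (bxor z₁ z₂) z₃} : Finset (Fin 4 → Bool)) := by
      intro v hv
      rw [mem_filter] at hv
      have hD := hzeroD v hv.2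
      simp only [mem_insert, mem_singleton]
      rcases hD with h | h | h | h
      · left; funext t; have := congrFun h t; simp only [bxor, zeroVec] at this ⊢; revert this; cases v t <;> cases z₁ t <;> decide
      · right; left; funext t; have := congrFun h t; simp only [bxor] at this ⊢; revert this; cases v t <;> cases z₁ t <;> cases z₂ t <;> decide
      · right; right; left; funext t; have := congrFun h t; simp only [bxor] at this ⊢; revert this
        cases v t <;> cases z₁ t <;> cases z₃ t <;> decide
      · right; right; right; funext t; have := congrFun h t; simp only [bxor] at this ⊢; revert this
        cases v t <;> cases z₁ t <;> cases z₂ t <;> cases z₃ t <;> decide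
    calc _ ≤ #({z₁, z₂, z₃, bxor (bxor z₁ z₂) z₃} : Finset (Fin 4 → Bool)) := by exact_mod_cast card_le_card hsub
      _ ≤ 4 := by
        refine (card_insert_le _ _).trans ?_
        refine (Nat.succ_le_succ (card_insert_le _ _)).trans ?_
        refine (Nat.succ_le_succ (Nat.succ_le_succ (card_insert_le _ _))).trans ?_
        rw [card_singleton]
  -- a light nonzero cell `v₁`
  have hlight : ∃ v₁ : Fin 4 → Bool, ((v₁ 0 && v₁ 1) ^^ (v₁ 2 && v₁ 3)) = false ∧ #(univ.filter fun s : Fin 7 → Bool => κ (Fin.append (Matrix.vecCons false v₁) s) = true) ≠ 0 ∧ #(univ.filter fun s : Fin 7 → Bool => κ (Fin.append (Matrix.vecCons false v₁) s) = true) < 48 := by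
    by_contra hno
    push Not at hno
    have key : ∀ v : Fin 4 → Bool, ((v 0 && v 1) ^^ (v 2 && v 3)) = false → 48 ≤ #(univ.filter fun s : Fin 7 → Bool => κ (Fin.append (Matrix.vecCons false v) s) = true) + 48 * (if #(univ.filter fun s : Fin 7 → Bool => κ (Fin.append (Matrix.vecCons false v) s) = true) = 0 then 1 else 0) := by
      intro v hv
      by_cases h0 : #(univ.filter fun s : Fin 7 → Bool => κ (Fin.append (Matrix.vecCons false v) s) = true) = 0
      · rw [h0]; simp
      · have := hno v hv h0; rw [if_neg h0]; omega
    have l0 := key ![false, false, false, false] (by decide)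
    have l1 := key ![false, false, false, true] (by decide)
    have l2 := key ![false, false, true, false] (by decide)
    have l3 := key ![false, true, false, false] (by decide)
    have l4 := key ![false, true, false, true] (by decide)
    have l5 := key ![false, true, true, false] (by decide)
    have l6 := key ![true, false, false, false] (by decide)
    have l7 := key ![true, false, false, true] (by decide)
    have l8 := key ![true, false, true, false] (by decide)
    have l9 := key ![true, true, true, true] (by decide)
    omega
  obtain ⟨v₁, hv₁, hW₁0, hW₁⟩ := hlight
  -- `v₁` has a nonzero form
  have hB₁ : ∃ j₁ k₁ : Fin 7, ((κ (Fin.append (Matrix.vecCons false v₁) zeroVec) ^^ κ (Fin.append (Matrix.vecCons false v₁) (fun l => decide (l = k₁)))) ^^ (κ (Fin.append (Matrix.vecCons false v₁) (fun l => decide (l = j₁))) ^^ κ (Fin.append (Matrix.vecCons false v₁) (bxor (fun l => decide (l = j₁)) (fun l => decide (l = k₁)))))) = true := by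
    by_contra hno
    push Not at hno
    have hne : ∃ s, κ (Fin.append (Matrix.vecCons false v₁) s) = true := by
      by_contra hn; push Not at hn; exact hW₁0 (hW0 v₁ (fun s => by simpa using hn s))
    have h64 := tq0_weight64_of_form_zero (fun s : Fin 7 → Bool => κ (Fin.append (Matrix.vecCons false v₁) s)) (hq v₁) (fun j m => by simpa using hno j m) hne
    omega
  obtain ⟨j₁, k₁, hjk₁⟩ := hB₁
  -- at most one cell of `Z₁₀` weighs exactly `64`
  have hT64 : 2 ^ #((univ.filter fun v : Fin 4 → Bool => ((v 0 && v 1) ^^ (v 2 && v 3)) = false).filter fun v => #(univ.filter fun s : Fin 7 → Bool => κ (Fin.append (Matrix.vecCons false v) s) = true) = 64) ≤ 2 := by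
    have h1 : #((univ.filter fun v : Fin 4 → Bool => ((v 0 && v 1) ^^ (v 2 && v 3)) = false).filter fun v => #(univ.filter fun s : Fin 7 → Bool => κ (Fin.append (Matrix.vecCons false v) s) = true) = 64) ≤ 1 := by
      by_contra hlt
      rw [not_le, one_lt_card] at hlt
      obtain ⟨p, hp, q, hq', hpq⟩ := hlt
      rw [mem_filter, mem_filter] at hp hq'
      exact tq0_budget_two64z (fun v => #(univ.filter fun s : Fin 7 → Bool => κ (Fin.append (Matrix.vecCons false v) s) = true)) hbudget p q hp.1.2 hq'.1.2 hpq (le_of_eq hp.2.symm) (le_of_eq hq'.2.symm) h32' hz4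
    calc 2 ^ #((univ.filter fun v : Fin 4 → Bool => ((v 0 && v 1) ^^ (v 2 && v 3)) = false).filter fun v => #(univ.filter fun s : Fin 7 → Bool => κ (Fin.append (Matrix.vecCons false v) s) = true) = 64) ≤ 2 ^ 1 :=
        Nat.pow_le_pow_right (by norm_num) h1
      _ = 2 := by norm_num
  -- the coordinates of `v₁`
  obtain ⟨c₁, c₂, hBv₁, hI₁⟩ := hP v₁
  have hc12 : (c₁ || c₂) = true := by
    by_contra h0
    have h0' : c₁ = false ∧ c₂ = false := by revert h0; cases c₁ <;> cases c₂ <;> simp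
    obtain ⟨rfl, rfl⟩ := h0'
    have := hBv₁ j₁ k₁; rw [hjk₁] at this; revert this
    cases ((κ (Fin.append (Matrix.vecCons false (bxor z₁ (fun l => decide (l = i)))) zeroVec) ^^ κ (Fin.append (Matrix.vecCons false (bxor z₁ (fun l => decide (l = i)))) (fun l => decide (l = k₁)))) ^^ (κ (Fin.append (Matrix.vecCons false (bxor z₁ (fun l => decide (l = i)))) (fun l => decide (l = j₁))) ^^ κ (Fin.append (Matrix.vecCons false (bxor z₁ (fun l => decide (l = i)))) (bxor (fun l => decide (l = j₁)) (fun l => decide (l = k₁)))))) <;> cases ((κ (Fin.append (Matrix.vecCons false (bxor z₁ (fun l => decide (l = j)))) zeroVec) ^^ κ (Fin.append (Matrix.vecCons false (bxor z₁ (fun l => decide (l = j)))) (fun l => decide (l = k₁)))) ^^ (κ (Fin.append (Matrix.vecCons false (bxor z₁ (fun l => decide (l = j)))) (fun l => decide (l = j₁))) ^^ κ (Fin.append (Matrix.vecCons false (bxor z₁ (fun l => decide (l = j)))) (bxor (fun l => decide (l = j₁)) (fun l => decide (l = k₁)))))) <;> decide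
  by_cases hsame : ∀ v : Fin 4 → Bool, ((v 0 && v 1) ^^ (v 2 && v 3)) = false → #(univ.filter fun s : Fin 7 → Bool => κ (Fin.append (Matrix.vecCons false v) s) = true) < 48 → (∃ j' k' : Fin 7, ((κ (Fin.append (Matrix.vecCons false v) zeroVec) ^^ κ (Fin.append (Matrix.vecCons false v) (fun l => decide (l = k')))) ^^ (κ (Fin.append (Matrix.vecCons false v) (fun l => decide (l = j'))) ^^ κ (Fin.append (Matrix.vecCons false v) (bxor (fun l => decide (l = j')) (fun l => decide (l = k')))))) = true) →
      ∀ j' k' : Fin 7, ((κ (Fin.append (Matrix.vecCons false v) zeroVec) ^^ κ (Fin.append (Matrix.vecCons false v) (fun l => decide (l = k')))) ^^ (κ (Fin.append (Matrix.vecCons false v) (fun l => decide (l = j'))) ^^ κ (Fin.append (Matrix.vecCons false v) (bxor (fun l => decide (l = j')) (fun l => decide (l = k')))))) = ((κ (Fin.append (Matrix.vecCons false v₁) zeroVec) ^^ κ (Fin.append (Matrix.vecCons false v₁) (fun l => decide (l = k')))) ^^ (κ (Fin.append (Matrix.vecCons false v₁) (fun l => decide (l = j'))) ^^ κ (Fin.append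 (Matrix.vecCons false v₁) (bxor (fun l => decide (l = j')) (fun l => decide (l = k'))))))
  · -- BUDGET: `α = a·(v ⊕ z₁)` with `a ⊥ D`, `a ⊥ c(v₁)`
    obtain ⟨a0, a1, a2, a3, ha, hd1, hd2, hc⟩ := tq0_orth3 ((bxor z₁ z₂) 0) ((bxor z₁ z₂) 1) ((bxor z₁ z₂) 2) ((bxor z₁ z₂) 3)
      ((bxor z₁ z₃) 0) ((bxor z₁ z₃) 1) ((bxor z₁ z₃) 2) ((bxor z₁ z₃) 3) ((bxor (fun l => c₁ && decide (l = i)) (fun l => c₂ && decide (l = j))) 0) ((bxor (fun l => c₁ && decide (l = i)) (fun l => c₂ && decide (l = j))) 1) ((bxor (fun l => c₁ && decide (l = i)) (fun l => c₂ && decide (l = j))) 2) ((bxor (fun l => c₁ && decide (l = i)) (fun l => c₂ && decide (l = j))) 3)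
    have hdotadd : ∀ x y : Fin 4 → Bool, (((a0 && (bxor x y) 0) ^^ (a1 && (bxor x y) 1)) ^^ ((a2 && (bxor x y) 2) ^^ (a3 && (bxor x y) 3))) = ((((a0 && x 0) ^^ (a1 && x 1)) ^^ ((a2 && x 2) ^^ (a3 && x 3))) ^^ (((a0 && y 0) ^^ (a1 && y 1)) ^^ ((a2 && y 2) ^^ (a3 && y 3)))) := by
      intro x y; simp only [bxor]
      generalize x 0 = x0; generalize x 1 = x1; generalize x 2 = x2; generalize x 3 = x3
      generalize y 0 = y0; generalize y 1 = y1; generalize y 2 = y2; generalize y 3 = y3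
      revert x0 x1 x2 x3 y0 y1 y2 y3; cases a0 <;> cases a1 <;> cases a2 <;> cases a3 <;> decide
    have hdot0 : (((a0 && (zeroVec : Fin 4 → Bool) 0) ^^ (a1 && (zeroVec : Fin 4 → Bool) 1)) ^^ ((a2 && (zeroVec : Fin 4 → Bool) 2) ^^ (a3 && (zeroVec : Fin 4 → Bool) 3))) = false := by simp [zeroVec]
    have hdotD : ∀ δ : Fin 4 → Bool, (δ = zeroVec ∨ δ = bxor z₁ z₂ ∨ δ = bxor z₁ z₃ ∨ δ = bxor z₂ z₃) → (((a0 && δ 0) ^^ (a1 && δ 1)) ^^ ((a2 && δ 2) ^^ (a3 && δ 3))) = false := by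
      intro δ hδ
      rcases hδ with rfl | rfl | rfl | rfl
      · exact hdot0
      · exact hd1
      · exact hd2
      · rw [show bxor z₂ z₃ = bxor (bxor z₁ z₂) (bxor z₁ z₃) from by
          funext t; simp only [bxor]; cases z₁ t <;> cases z₂ t <;> cases z₃ t <;> rfl, hdotadd, hd1, hd2]; rfl
    -- `α(v) := a·z₁ ⊕ a·v`; its value on a cell with coordinates `(cx, cy)` is `cx·(a·e_i) ⊕ cy·(a·e_j)`
    have hAF : ∀ v : Fin 4 → Bool, (((((((a0 && z₁ 0) ^^ (a1 && z₁ 1)) ^^ ((a2 && z₁ 2) ^^ (a3 && z₁ 3))) ^^ (v 0 && a0)) ^^ (v 1 && a1)) ^^ (v 2 && a2)) ^^ (v 3 && a3)) = ((((a0 && z₁ 0) ^^ (a1 && z₁ 1)) ^^ ((a2 && z₁ 2) ^^ (a3 && z₁ 3))) ^^ (((a0 && v 0) ^^ (a1 && v 1)) ^^ ((a2 && v 2) ^^ (a3 && v 3)))) := by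
      intro v
      generalize v 0 = x0; generalize v 1 = x1; generalize v 2 = x2; generalize v 3 = x3
      generalize z₁ 0 = y0; generalize z₁ 1 = y1; generalize z₁ 2 = y2; generalize z₁ 3 = y3
      revert x0 x1 x2 x3 y0 y1 y2 y3; cases a0 <;> cases a1 <;> cases a2 <;> cases a3 <;> decide
    have hdotc : ∀ cx cy : Bool, (((a0 && (bxor (fun l => cx && decide (l = i)) (fun l => cy && decide (l = j))) 0) ^^ (a1 && (bxor (fun l => cx && decide (l = i)) (fun l => cy && decide (l = j))) 1)) ^^ ((a2 && (bxor (fun l => cx && decide (l = i)) (fun l => cy && decide (l = j))) 2) ^^ (a3 && (bxor (fun l => cx && decide (l = i)) (fun l => cy && decide (l = j))) 3))) =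
        ((cx && (((a0 && (fun l => decide (l = i)) 0) ^^ (a1 && (fun l => decide (l = i)) 1)) ^^ ((a2 && (fun l => decide (l = i)) 2) ^^ (a3 && (fun l => decide (l = i)) 3)))) ^^ (cy && (((a0 && (fun l => decide (l = j)) 0) ^^ (a1 && (fun l => decide (l = j)) 1)) ^^ ((a2 && (fun l => decide (l = j)) 2) ^^ (a3 && (fun l => decide (l = j)) 3))))) := by
      intro cx cy
      simp only [bxor]
      generalize decide ((0 : Fin 4) = i) = i0; generalize decide ((1 : Fin 4) = i) = i1
      generalize decide ((2 : Fin 4) = i) = i2; generalize decide ((3 : Fin 4) = i) = i3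
      generalize decide ((0 : Fin 4) = j) = j0; generalize decide ((1 : Fin 4) = j) = j1
      generalize decide ((2 : Fin 4) = j) = j2; generalize decide ((3 : Fin 4) = j) = j3
      revert cx cy i0 i1 i2 i3 j0 j1 j2 j3; cases a0 <;> cases a1 <;> cases a2 <;> cases a3 <;> decide
    have hαval : ∀ (v : Fin 4 → Bool) (cx cy : Bool), ((bxor (bxor (bxor v z₁) (fun l => cx && decide (l = i))) (fun l => cy && decide (l = j))) = zeroVec ∨ (bxor (bxor (bxor v z₁) (fun l => cx && decide (l = i))) (fun l => cy && decide (l = j))) = bxor z₁ z₂ ∨ (bxor (bxor (bxor v z₁) (fun l => cx && decide (l = i))) (fun l => cy && decide (l = j))) = bxor z₁ z₃ ∨ (bxor (bxor (bxor v z₁) (fun l => cx && decide (l = i))) (fun l => cy && decide (l = j))) = bxor z₂ z₃) →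
        (((((((a0 && z₁ 0) ^^ (a1 && z₁ 1)) ^^ ((a2 && z₁ 2) ^^ (a3 && z₁ 3))) ^^ (v 0 && a0)) ^^ (v 1 && a1)) ^^ (v 2 && a2)) ^^ (v 3 && a3)) = ((cx && (((a0 && (fun l => decide (l = i)) 0) ^^ (a1 && (fun l => decide (l = i)) 1)) ^^ ((a2 && (fun l => decide (l = i)) 2) ^^ (a3 && (fun l => decide (l = i)) 3)))) ^^ (cy && (((a0 && (fun l => decide (l = j)) 0) ^^ (a1 && (fun l => decide (l = j)) 1)) ^^ ((a2 && (fun l => decide (l = j)) 2) ^^ (a3 && (fun l => decide (l = j)) 3))))) := by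
      intro v cx cy hI
      have e1 := hdotD _ hI
      rw [hdotadd, hdotadd, hdotadd] at e1
      rw [hAF, ← hdotc, hdotadd]
      revert e1
      generalize (((a0 && v 0) ^^ (a1 && v 1)) ^^ ((a2 && v 2) ^^ (a3 && v 3))) = Dv
      generalize (((a0 && z₁ 0) ^^ (a1 && z₁ 1)) ^^ ((a2 && z₁ 2) ^^ (a3 && z₁ 3))) = Dz'
      generalize (((a0 && (fun l => cx && decide (l = i)) 0) ^^ (a1 && (fun l => cx && decide (l = i)) 1)) ^^ ((a2 && (fun l => cx && decide (l = i)) 2) ^^ (a3 && (fun l => cx && decide (l = i)) 3))) = Di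
      generalize (((a0 && (fun l => cy && decide (l = j)) 0) ^^ (a1 && (fun l => cy && decide (l = j)) 1)) ^^ ((a2 && (fun l => cy && decide (l = j)) 2) ^^ (a3 && (fun l => cy && decide (l = j)) 3))) = Dj
      cases Dv <;> cases Dz' <;> cases Di <;> cases Dj <;> decide
    have hc' : ((c₁ && (((a0 && (fun l => decide (l = i)) 0) ^^ (a1 && (fun l => decide (l = i)) 1)) ^^ ((a2 && (fun l => decide (l = i)) 2) ^^ (a3 && (fun l => decide (l = i)) 3)))) ^^ (c₂ && (((a0 && (fun l => decide (l = j)) 0) ^^ (a1 && (fun l => decide (l = j)) 1)) ^^ ((a2 && (fun l => decide (l = j)) 2) ^^ (a3 && (fun l => decide (l = j)) 3))))) = false := by rw [← hdotc]; exact hc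
    -- cells with `α = 1` weigh `≥ 48`
    have h48 : ∀ v : Fin 4 → Bool, ((v 0 && v 1) ^^ (v 2 && v 3)) = false → (((((((a0 && z₁ 0) ^^ (a1 && z₁ 1)) ^^ ((a2 && z₁ 2) ^^ (a3 && z₁ 3))) ^^ (v 0 && a0)) ^^ (v 1 && a1)) ^^ (v 2 && a2)) ^^ (v 3 && a3)) = true → 48 ≤ #(univ.filter fun s : Fin 7 → Bool => κ (Fin.append (Matrix.vecCons false v) s) = true) := by
      intro v hv hα
      obtain ⟨cx, cy, hT, hI⟩ := hP v
      rw [hαval v cx cy hI] at hα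
      -- not a zero cell
      have hW0' : #(univ.filter fun s : Fin 7 → Bool => κ (Fin.append (Matrix.vecCons false v) s) = true) ≠ 0 := by
        intro h0
        have hD := hzeroD v h0
        have e0 := hαval v false false (by rw [tcf_smul_false, tcf_smul_false, bxor_zeroVec, bxor_zeroVec]; exact hD)
        rw [hαval v cx cy hI, Bool.false_and, Bool.false_and] at e0
        rw [e0] at hα
        exact Bool.false_ne_true hα
      by_contra hlt
      rw [not_le] at hlt
      -- nonzero form, hence (by `hsame`) the form of `v₁`: coordinates agree, contradicting `α(v) = 1`, `α`-value of `v₁` is `0`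
      have hformne : ∃ j' k' : Fin 7, ((κ (Fin.append (Matrix.vecCons false v) zeroVec) ^^ κ (Fin.append (Matrix.vecCons false v) (fun l => decide (l = k')))) ^^ (κ (Fin.append (Matrix.vecCons false v) (fun l => decide (l = j'))) ^^ κ (Fin.append (Matrix.vecCons false v) (bxor (fun l => decide (l = j')) (fun l => decide (l = k')))))) = true := by
        by_contra hno
        push Not at hno
        have hne : ∃ s, κ (Fin.append (Matrix.vecCons false v) s) = true := by
          by_contra hn; push Not at hn; exact hW0' (hW0 v (fun s => by simpa using hn s))
        have h64 := tq0_weight64_of_form_zero (fun s : Fin 7 → Bool => κ (Fin.append (Matrix.vecCons false v) s)) (hq v) (fun j m => by simpa using hno j m) hne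
        omega
      have hsv := hsame v hv hlt hformne
      obtain ⟨ecx, ecy⟩ := hindep (cx ^^ c₁) (cy ^^ c₂) (fun j' k' => by
        have e1 := hsv j' k'; rw [hT j' k', hBv₁ j' k'] at e1; revert e1
        cases ((κ (Fin.append (Matrix.vecCons false (bxor z₁ (fun l => decide (l = i)))) zeroVec) ^^ κ (Fin.append (Matrix.vecCons false (bxor z₁ (fun l => decide (l = i)))) (fun l => decide (l = k')))) ^^ (κ (Fin.append (Matrix.vecCons false (bxor z₁ (fun l => decide (l = i)))) (fun l => decide (l = j'))) ^^ κ (Fin.append (Matrix.vecCons false (bxor z₁ (fun l => decide (l = i)))) (bxor (fun l => decide (l = j')) (fun l => decide (l = k')))))) <;> cases ((κ (Fin.append (Matrix.vecCons false (bxor z₁ (fun l => decide (l = j)))) zeroVec) ^^ κ (Fin.append (Matrix.vecCons false (bxor z₁ (fun l => decide (l = j)))) (fun l => decide (l = k')))) ^^ (κ (Fin.append (Matrix.vecCons false (bxor z₁ (fun l => decide (l = j)))) (fun l => decide (l = j'))) ^^ κ (Fin.append (Matrix.vecCons false (bxor z₁ (fun l => decide (l = j)))) (bxor (fun l => decide (l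 = j')) (fun l => decide (l = k')))))) <;> cases cx <;> cases cy <;> cases c₁ <;> cases c₂ <;> decide)
      have ecx' : cx = c₁ := by revert ecx; cases cx <;> cases c₁ <;> decide
      have ecy' : cy = c₂ := by revert ecy; cases cy <;> cases c₂ <;> decide
      rw [ecx', ecy', hc'] at hα
      exact Bool.false_ne_true hα
    have h32z : ∀ v : Fin 4 → Bool, ((v 0 && v 1) ^^ (v 2 && v 3)) = false → (((((((a0 && z₁ 0) ^^ (a1 && z₁ 1)) ^^ ((a2 && z₁ 2) ^^ (a3 && z₁ 3))) ^^ (v 0 && a0)) ^^ (v 1 && a1)) ^^ (v 2 && a2)) ^^ (v 3 && a3)) = false → #(univ.filter fun s : Fin 7 → Bool => κ (Fin.append (Matrix.vecCons false v) s) = true) = 0 ∨ 32 ≤ #(univ.filter fun s : Fin 7 → Bool => κ (Fin.append (Matrix.vecCons false v) s) = true) :=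
      fun v hv _ => h32' v hv
    exact tq0_budget_2flat (fun v => #(univ.filter fun s : Fin 7 → Bool => κ (Fin.append (Matrix.vecCons false v) s) = true)) hbudget ((((a0 && z₁ 0) ^^ (a1 && z₁ 1)) ^^ ((a2 && z₁ 2) ^^ (a3 && z₁ 3)))) a0 a1 a2 a3 ha h48 h32z hz4
  · -- PIGEONHOLE: a second light cell `v₂` with a different (nonzero) form
    push Not at hsame
    obtain ⟨v₂, hv₂, hW₂, ⟨j₂, k₂, hjk₂⟩, ⟨jd, kd, hdiff⟩⟩ := hsame
    obtain ⟨c₁', c₂', hBv₂, -⟩ := hP v₂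
    -- the radicals of the two light forms
    have hx₁ : ((κ (Fin.append (Matrix.vecCons false v₁) zeroVec) ^^ κ (Fin.append (Matrix.vecCons false v₁) (bxor zeroVec (fun l => decide (l = k₁))))) ^^ (κ (Fin.append (Matrix.vecCons false v₁) (bxor zeroVec (fun l => decide (l = j₁)))) ^^ κ (Fin.append (Matrix.vecCons false v₁) (bxor (bxor zeroVec (fun l => decide (l = j₁))) (fun l => decide (l = k₁)))))) = true := by
      simp only [zeroVec_bxor]; exact hjk₁
    have hx₂ : ((κ (Fin.append (Matrix.vecCons false v₂) zeroVec) ^^ κ (Fin.append (Matrix.vecCons false v₂) (bxor zeroVec (fun l => decide (l = k₂))))) ^^ (κ (Fin.append (Matrix.vecCons false v₂) (bxor zeroVec (fun l => decide (l = j₂)))) ^^ κ (Fin.append (Matrix.vecCons false v₂) (bxor (bxor zeroVec (fun l => decide (l = j₂))) (fun l => decide (l = k₂)))))) = true := by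
      simp only [zeroVec_bxor]; exact hjk₂
    have hrad₁ := tq0_rad32 (fun s : Fin 7 → Bool => κ (Fin.append (Matrix.vecCons false v₁) s)) (hq v₁) (fun l => decide (l = j₁)) (fun l => decide (l = k₁)) hx₁ hW₁
    have hrad₂ := tq0_rad32 (fun s : Fin 7 → Bool => κ (Fin.append (Matrix.vecCons false v₂) s)) (hq v₂) (fun l => decide (l = j₂)) (fun l => decide (l = k₂)) hx₂ hW₂
    have hclosed : ∀ v : Fin 4 → Bool, ∀ x ∈ (univ.filter fun r : Fin 7 → Bool => ∀ y : Fin 7 → Bool,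
        ((κ (Fin.append (Matrix.vecCons false v) zeroVec) ^^ κ (Fin.append (Matrix.vecCons false v) (bxor zeroVec y))) ^^ (κ (Fin.append (Matrix.vecCons false v) (bxor zeroVec r)) ^^ κ (Fin.append (Matrix.vecCons false v) (bxor (bxor zeroVec r) y)))) = false), ∀ y ∈ (univ.filter fun r : Fin 7 → Bool => ∀ y : Fin 7 → Bool,
        ((κ (Fin.append (Matrix.vecCons false v) zeroVec) ^^ κ (Fin.append (Matrix.vecCons false v) (bxor zeroVec y))) ^^ (κ (Fin.append (Matrix.vecCons false v) (bxor zeroVec r)) ^^ κ (Fin.append (Matrix.vecCons false v) (bxor (bxor zeroVec r) y)))) = false),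
        bxor x y ∈ (univ.filter fun r : Fin 7 → Bool => ∀ y : Fin 7 → Bool,
        ((κ (Fin.append (Matrix.vecCons false v) zeroVec) ^^ κ (Fin.append (Matrix.vecCons false v) (bxor zeroVec y))) ^^ (κ (Fin.append (Matrix.vecCons false v) (bxor zeroVec r)) ^^ κ (Fin.append (Matrix.vecCons false v) (bxor (bxor zeroVec r) y)))) = false) := by
      intro v x hx y hy
      rw [mem_filter] at hx hy ⊢
      refine ⟨mem_univ _, fun w => ?_⟩
      obtain ⟨-, hadd, -, -⟩ := tcb_form_basic (fun s : Fin 7 → Bool => κ (Fin.append (Matrix.vecCons false v) s))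
        (fun r y => ((κ (Fin.append (Matrix.vecCons false v) zeroVec) ^^ κ (Fin.append (Matrix.vecCons false v) (bxor zeroVec y))) ^^ (κ (Fin.append (Matrix.vecCons false v) (bxor zeroVec r)) ^^ κ (Fin.append (Matrix.vecCons false v) (bxor (bxor zeroVec r) y))))) (fun r y x' => tl2_second_const (fun s : Fin 7 → Bool => κ (Fin.append (Matrix.vecCons false v) s)) (hq v) r y x')
      rw [hadd x y w, hx.2 w, hy.2 w]; rfl
    have h8 := tq0_inter8 (univ.filter fun r : Fin 7 → Bool => ∀ y : Fin 7 → Bool,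
        ((κ (Fin.append (Matrix.vecCons false v₁) zeroVec) ^^ κ (Fin.append (Matrix.vecCons false v₁) (bxor zeroVec y))) ^^ (κ (Fin.append (Matrix.vecCons false v₁) (bxor zeroVec r)) ^^ κ (Fin.append (Matrix.vecCons false v₁) (bxor (bxor zeroVec r) y)))) = false) (univ.filter fun r : Fin 7 → Bool => ∀ y : Fin 7 → Bool,
        ((κ (Fin.append (Matrix.vecCons false v₂) zeroVec) ^^ κ (Fin.append (Matrix.vecCons false v₂) (bxor zeroVec y))) ^^ (κ (Fin.append (Matrix.vecCons false v₂) (bxor zeroVec r)) ^^ κ (Fin.append (Matrix.vecCons false v₂) (bxor (bxor zeroVec r) y)))) = false)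
      (hclosed v₁) (hclosed v₂) hrad₁ hrad₂
    -- determinant of the coordinates of `v₁, v₂`
    have hdet : ((c₁ && c₂') ^^ (c₂ && c₁')) = true := by
      have hne2 : (c₁' || c₂') = true := by
        by_contra h0
        have h0' : c₁' = false ∧ c₂' = false := by revert h0; cases c₁' <;> cases c₂' <;> simp
        obtain ⟨rfl, rfl⟩ := h0'
        have := hBv₂ j₂ k₂; rw [hjk₂] at this; revert this
        cases ((κ (Fin.append (Matrix.vecCons false (bxor z₁ (fun l => decide (l = i)))) zeroVec) ^^ κ (Fin.append (Matrix.vecCons false (bxor z₁ (fun l => decide (l = i)))) (fun l => decide (l = k₂)))) ^^ (κ (Fin.append (Matrix.vecCons false (bxor z₁ (fun l => decide (l = i)))) (fun l => decide (l = j₂))) ^^ κ (Fin.append (Matrix.vecCons false (bxor z₁ (fun l => decide (l = i)))) (bxor (fun l => decide (l = j₂)) (fun l => decide (l = k₂)))))) <;> cases ((κ (Fin.append (Matrix.vecCons false (bxor z₁ (fun l => decide (l = j)))) zeroVec) ^^ κ (Fin.append (Matrix.vecCons false (bxor z₁ (fun l => decide (l = j)))) (fun l => decide (l = k₂)))) ^^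 (κ (Fin.append (Matrix.vecCons false (bxor z₁ (fun l => decide (l = j)))) (fun l => decide (l = j₂))) ^^ κ (Fin.append (Matrix.vecCons false (bxor z₁ (fun l => decide (l = j)))) (bxor (fun l => decide (l = j₂)) (fun l => decide (l = k₂)))))) <;> decide
      have hneq : ¬ (c₁ = c₁' ∧ c₂ = c₂') := by
        rintro ⟨rfl, rfl⟩
        apply hdiff
        rw [hBv₂ jd kd, hBv₁ jd kd]
      revert hc12 hne2 hneq
      cases c₁ <;> cases c₂ <;> cases c₁' <;> cases c₂' <;> simp
    refine tq0_pigeon κ hκ c d hdc hds hd hpair hF hzzz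
      ((univ.filter fun r : Fin 7 → Bool => ∀ y : Fin 7 → Bool,
        ((κ (Fin.append (Matrix.vecCons false v₁) zeroVec) ^^ κ (Fin.append (Matrix.vecCons false v₁) (bxor zeroVec y))) ^^ (κ (Fin.append (Matrix.vecCons false v₁) (bxor zeroVec r)) ^^ κ (Fin.append (Matrix.vecCons false v₁) (bxor (bxor zeroVec r) y)))) = false) ∩
       (univ.filter fun r : Fin 7 → Bool => ∀ y : Fin 7 → Bool,
        ((κ (Fin.append (Matrix.vecCons false v₂) zeroVec) ^^ κ (Fin.append (Matrix.vecCons false v₂) (bxor zeroVec y))) ^^ (κ (Fin.append (Matrix.vecCons false v₂) (bxor zeroVec r)) ^^ κ (Fin.append (Matrix.vecCons false v₂) (bxor (bxor zeroVec r) y)))) = false))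
      (fun u hu v k => ?_) (lt_of_le_of_lt hT64 (by omega))
    rw [mem_inter, mem_filter, mem_filter] at hu
    have hu₁ := hu.1.2 (fun l => decide (l = k))
    have hu₂ := hu.2.2 (fun l => decide (l = k))
    simp only [zeroVec_bxor] at hu₁ hu₂
    obtain ⟨cx, cy, hT, -⟩ := hP v
    have hrow := tq0_row_comb (fun s : Fin 7 → Bool => κ (Fin.append (Matrix.vecCons false v) s)) (fun s : Fin 7 → Bool => κ (Fin.append (Matrix.vecCons false v₁) s)) (fun s : Fin 7 → Bool => κ (Fin.append (Matrix.vecCons false v₂) s)) (hq v) (hq v₁) (hq v₂)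
      ((cx && c₂') ^^ (cy && c₁')) ((cx && c₂) ^^ (cy && c₁))
      (fun j' k' => by
        rw [hT j' k', hBv₁ j' k', hBv₂ j' k']
        revert hdet
        generalize ((κ (Fin.append (Matrix.vecCons false (bxor z₁ (fun l => decide (l = i)))) zeroVec) ^^ κ (Fin.append (Matrix.vecCons false (bxor z₁ (fun l => decide (l = i)))) (fun l => decide (l = k')))) ^^ (κ (Fin.append (Matrix.vecCons false (bxor z₁ (fun l => decide (l = i)))) (fun l => decide (l = j'))) ^^ κ (Fin.append (Matrix.vecCons false (bxor z₁ (fun l => decide (l = i)))) (bxor (fun l => decide (l = j')) (fun l => decide (l = k')))))) = x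
        generalize ((κ (Fin.append (Matrix.vecCons false (bxor z₁ (fun l => decide (l = j)))) zeroVec) ^^ κ (Fin.append (Matrix.vecCons false (bxor z₁ (fun l => decide (l = j)))) (fun l => decide (l = k')))) ^^ (κ (Fin.append (Matrix.vecCons false (bxor z₁ (fun l => decide (l = j)))) (fun l => decide (l = j'))) ^^ κ (Fin.append (Matrix.vecCons false (bxor z₁ (fun l => decide (l = j)))) (bxor (fun l => decide (l = j')) (fun l => decide (l = k')))))) = y
        cases cx <;> cases cy <;> cases c₁ <;> cases c₂ <;> cases c₁' <;> cases c₂' <;> cases x <;> cases y <;> decide) u k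
    rw [hrow, hu₁, hu₂]
    generalize ((cx && c₂') ^^ (cy && c₁')) = b1
    generalize ((cx && c₂) ^^ (cy && c₁)) = b2
    cases b1 <;> cases b2 <;> rfl

end Summit.QuantumAdvantage.QuantumAdvantage.Theorems.CubicForrelation.NearExactIsExact
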